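import Literature.MathematicalPhysics.QuantumFieldTheory.Balaban1983to89.T3AveragedTailProfile
import Literature.MathematicalPhysics.QuantumFieldTheory.Balaban1983to89.T3HistoryTailReduction
import HarnessLib

/-!
# K2's body `HistoryTailAt … m` from a per-plaquette tail WITH A LEVEL-GEOMETRIC LOSS `R^j` — the bookkeeping half of the glue
# `HistoryTailOfNotch` (stmt-QuantumFields-26204) of route `CutoffNotchTransport`, route-independent (no `Theses` import)

Seat `ym-line-sfw-p1` g11 (home cell `ym-idea-1`), `--supports stmt-QuantumFields-26204`.

WHAT.  ★★ `historyTailAt_of_perPlaquette_rated`: let `0 < γ ≤ 1`, `0 < b₀`, `1 ≤ p₀`, `m ≥ 1`, and suppose a per-plaquette large-field tail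
with a loss GEOMETRIC IN THE LEVEL: `C ≥ 0`, `R ≥ 1`, `A : ℕ`, `c > 0` with, for every run `K`, every level `j ≤ K` and every plaquette `p` of
`T^{(j)}`, `Gibbs_K{θ(K−j) ≤ |Ū^{j}(∂p) − 1|} ≤ C·R^j·β_{K−j}^A·exp(−c·p(g_{K−j})²)` (`β_h = (γL^{−h})⁻¹`, `θ = θBal`, `p = B10.pFun b₀ p₀`).  Then
`HistoryTailAt F γ b₀ p₀ m`.  This is the currency the induction over ultraviolet notches delivers (`R = A` the notch constant, `j` notches
between the bare lattice and level `j`); the tree's `T3AveragedTailProfile.historyTailAt_of_perPlaquette` is the case `R = 1`.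

THE ARGUMENT.  `histGood K ⌊K/m⌋` (resp. `histGood (K+1) ⌊K/m⌋`) constrains only the heights `h ≥ ⌊K/m⌋`, where `j = K − h ≤ m(h+1)`
(resp. `j = K + 1 − h ≤ m(h+1)`); there `R^j ≤ R^m·(R^m)^h ≤ R^m·β_h^{N''}` for any `N''` with `R^m ≤ L^{N''}` (`L^h ≤ β_h` as `γ ≤ 1`), so on the
constrained heights the rated tail is an honest schema tail with constants `(C·R^m, A + N'', c)`; the union bound over the `≤ 9·(2L^{m_F+h})³`
plaquettes of a height and «Gaussian beats exponential» (`T3AveragedTailProfile.perHeight_bound`: `… ≤ A'·2^{−h}`) give per height `A'·2^{−h}`,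
summed over `h ≥ ⌊K/m⌋`: `w_K = 4A'·2^{−⌊K/m⌋}`, summable (`T3HistoryTailReduction.summable_comp_div`).

HONEST FRAMING.  Pure bookkeeping over the tree's definitions; no estimate of Bałaban's is asserted; the crux `NotchMomentRatioL`
(stmt-QuantumFields-26202) is untouched; rung R3 is a RECORD rung — no summit, no Clay claim.  No `def`, no `sorry`.

References: T. Bałaban, CMP **102** (1985) 255–275 [Balaban1985UV3] ((7) p.257, (71) p.273); C. King, CMP **102** (1986) 649–677 [King1986]
((3.12) p.657: the free top fraction `1/m`).
-/

set_option autoImplicit false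

noncomputable section

open MeasureTheory
open scoped BigOperators

namespace Summit.QuantumFields.YangMills.Theorems.CutoffNotchTransport

open Literature.MathematicalPhysics.QuantumFieldTheory
open Literature.MathematicalPhysics.QuantumFieldTheory.Balaban1983to89
open Literature.MathematicalPhysics.QuantumFieldTheory.Balaban1983to89.T3ContinuumYM3Torus
open Literature.MathematicalPhysics.QuantumFieldTheory.Balaban1983to89.T3UnitScaleTilt
open Literature.MathematicalPhysics.QuantumFieldTheory.Balaban1983to89.T3UnitLawDensityEML (ℰp)
open Literature.MathematicalPhysics.QuantumFieldTheory.Balaban1983to89.T3CruxEstimates (real_not_plaqSmall_comp_le_sum)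
open Literature.MathematicalPhysics.QuantumFieldTheory.Balaban1983to89.T3AveragedTailProfile (perHeight_bound)
open Literature.MathematicalPhysics.QuantumFieldTheory.Balaban1983to89.T3HistoryTailReduction (summable_comp_div real_compl_histGood_le_sum)

/-! ## §1 Counting and arithmetic -/

/-- `#plaquettes of T^{(j)}_K ≤ 9·(2L^{m+K−j})³ = 72·L^{3m}(L^{K−j})³` (`j ≤ K`; `d² = 9` plane labels per site; cf. the cone-bound twin
`HistoryTailOfTwoSided.card_plaq_le_pow`).
[cite: Balaban1985UV3, (1)-(3) p.256] -/
theorem card_plaq_le_height (F : T3Family) {K j : ℕ} (hj : j ≤ K) :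
    (Fintype.card (Plaq (F.P K) j) : ℝ) ≤ 72 * (F.L : ℝ) ^ (3 * F.m) * ((F.L : ℝ) ^ (K - j)) ^ 3 := by
  have h1 : Fintype.card (Plaq (F.P K) j) = Fintype.card (Plaquette 3 ((F.P K).sitesPerDir j)) :=
    Fintype.card_congr (plaqEquiv (P := F.P K) j)
  have h2 : Fintype.card (Plaquette 3 ((F.P K).sitesPerDir j)) ≤ ((F.P K).sitesPerDir j) ^ 3 * 3 ^ 2 := by
    rw [Fintype.card_prod, Fintype.card_fun, ZMod.card, Fintype.card_fin]
    gcongr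
    calc Fintype.card {p : Fin 3 × Fin 3 // p.1 < p.2} ≤ Fintype.card (Fin 3 × Fin 3) := Fintype.card_subtype_le _
      _ = 3 ^ 2 := by rw [Fintype.card_prod, Fintype.card_fin]; norm_num
  have hsites : ((F.P K).sitesPerDir j : ℝ) = 2 * (F.L : ℝ) ^ (F.m + (K - j)) := by
    rw [show (F.P K).sitesPerDir j = 2 * F.L ^ (F.m + K - j) from rfl, show F.m + K - j = F.m + (K - j) by omega]
    push_cast; ring
  rw [h1]
  calc (Fintype.card (Plaquette 3 ((F.P K).sitesPerDir j)) : ℝ) ≤ (((F.P K).sitesPerDir j) ^ 3 * 3 ^ 2 : ℕ) := by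
        exact_mod_cast h2
    _ = 72 * (F.L : ℝ) ^ (3 * F.m) * ((F.L : ℝ) ^ (K - j)) ^ 3 := by push_cast; rw [hsites]; ring

/-- `Σ_{j ≤ K−n} 2^{−(K−j)} ≤ 2·2^{−n}` (`n ≤ K`): the geometric tail over the constrained heights `h = K − j ≥ n`. [folklore] -/
theorem sum_range_half_pow_le {K n : ℕ} (hn : n ≤ K) :
    ∑ j ∈ Finset.range (K - n + 1), ((1 : ℝ) / 2) ^ (K - j) ≤ 2 * ((1 : ℝ) / 2) ^ n := by
  have key : ∑ j ∈ Finset.range (K - n + 1), ((1 : ℝ) / 2) ^ (K - j) =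
      ∑ t ∈ Finset.range (K - n + 1), ((1 : ℝ) / 2) ^ (t + n) := by
    rw [← Finset.sum_range_reflect (fun t => ((1 : ℝ) / 2) ^ (t + n)) (K - n + 1)]
    refine Finset.sum_congr rfl fun j hj => ?_
    rw [Finset.mem_range] at hj
    congr 1; omega
  rw [key]
  have hs : Summable (fun t : ℕ => ((1 : ℝ) / 2) ^ t) := summable_geometric_of_lt_one (by norm_num) (by norm_num)
  calc ∑ t ∈ Finset.range (K - n + 1), ((1 : ℝ) / 2) ^ (t + n)
      = ((1 : ℝ) / 2) ^ n * ∑ t ∈ Finset.range (K - n + 1), ((1 : ℝ) / 2) ^ t := by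
        rw [Finset.mul_sum]
        refine Finset.sum_congr rfl fun t _ => ?_
        rw [pow_add]; ring
    _ ≤ ((1 : ℝ) / 2) ^ n * 2 := by
        refine mul_le_mul_of_nonneg_left ?_ (by positivity)
        refine (hs.sum_le_tsum _ fun t _ => by positivity).trans ?_
        rw [tsum_geometric_of_lt_one (by norm_num) (by norm_num)]; norm_num
    _ = 2 * ((1 : ℝ) / 2) ^ n := by ring

/-- For `R ≥ 1` and `j ≤ m(h+1)`: `R^j ≤ R^m·(R^m)^h`. [folklore] -/
theorem pow_le_pow_mul_pow {R : ℝ} (hR : 1 ≤ R) {j m h : ℕ} (hj : j ≤ m * (h + 1)) : R ^ j ≤ R ^ m * (R ^ m) ^ h := by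
  rw [← pow_mul, ← pow_add, show m + m * h = m * (h + 1) by ring]
  exact pow_le_pow_right₀ hR hj

/-- `L^h ≤ β_h = (γL^{−h})⁻¹` for `0 < γ ≤ 1` (`L ≥ 1`). [cite: Balaban1985UV3, (1)-(3) p.256] -/
theorem pow_le_beta (F : T3Family) {γ : ℝ} (hγ : 0 < γ) (hγ1 : γ ≤ 1) (h : ℕ) :
    (F.L : ℝ) ^ h ≤ (γ * ((F.L : ℝ)⁻¹) ^ h)⁻¹ := by
  have hL0 : (0 : ℝ) < F.L := by exact_mod_cast lt_trans zero_lt_one F.hL.2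
  have hLh : (0 : ℝ) < (F.L : ℝ) ^ h := pow_pos hL0 h
  rw [inv_pow, mul_inv, inv_inv]
  calc (F.L : ℝ) ^ h = 1 * (F.L : ℝ) ^ h := (one_mul _).symm
    _ ≤ γ⁻¹ * (F.L : ℝ) ^ h := mul_le_mul_of_nonneg_right (one_le_inv₀ hγ |>.mpr hγ1) hLh.le

/-! ## §2 The rated per-plaquette tail implies K2's body -/

/-- ★★ **`HistoryTailAt … m` FROM A PER-PLAQUETTE TAIL WITH LEVEL-GEOMETRIC LOSS `R^j`** (module docstring): the loss is absorbed into the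
power of `β_h` on the heights `h ≥ ⌊K/m⌋` that `histGood … K ⌊K/m⌋` (and its run-`K+1` twin) constrain, then union bound over plaquettes,
`perHeight_bound`, geometric sum over the constrained heights, `summable_comp_div`. [cite: Balaban1985UV3, (7) p.257 and (71) p.273; King1986, (3.12) p.657] -/
theorem historyTailAt_of_perPlaquette_rated (F : T3Family) {γ b₀ p₀ : ℝ} (hγ : 0 < γ) (hγ1 : γ ≤ 1) (hb₀ : 0 < b₀) (hp₀ : 1 ≤ p₀)
    {m : ℕ} (hm : 0 < m) {C R c : ℝ} {A : ℕ} (hC : 0 ≤ C) (hR : 1 ≤ R) (hc : 0 < c)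
    (h : ∀ (K j : ℕ), j ≤ K → ∀ p : Plaq (F.P K) j,
      (gibbsK F ℰp γ K).real
          {U | θBal F.L γ b₀ p₀ (K - j) ≤
            GaugeGroup.dist1 (GaugeField.plaqHol
              (Averaging.iter (fun i => BlockAveraging.blockAvg (P := F.P K) (j := i) ℰp) j U) p)} ≤
        C * R ^ j * (γ * ((F.L : ℝ)⁻¹) ^ (K - j))⁻¹ ^ A *
          Real.exp (-(c * B10.pFun b₀ p₀ (Real.sqrt (γ * ((F.L : ℝ)⁻¹) ^ (K - j))) ^ 2))) :
    HistoryTailAt F γ b₀ p₀ m := by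
  have hL1 : (1 : ℝ) < F.L := by exact_mod_cast F.hL.2
  have hL0 : (0 : ℝ) < F.L := one_pos.trans hL1
  -- absorb the rate: `R^m ≤ L^{N''}`
  obtain ⟨N'', hN''⟩ := pow_unbounded_of_one_lt (R ^ m) hL1
  have hRm0 : 0 ≤ R ^ m := pow_nonneg (zero_le_one.trans hR) m
  -- the schema constants on the constrained heights and the per-height constant of `perHeight_bound`
  set C' : ℝ := C * R ^ m with hC'
  have hC'0 : 0 ≤ C' := mul_nonneg hC hRm0
  set A' : ℝ := 72 * C' * (F.L : ℝ) ^ (3 * F.m) * γ⁻¹ ^ (A + N'') *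
      Real.exp ((((3 : ℝ) + (A + N'' : ℕ)) * Real.log F.L + Real.log 2) ^ 2 / (4 * (c * b₀ ^ 2 * Real.log F.L ^ 2 / 4))) with hA'
  have hA'0 : 0 ≤ A' := by rw [hA']; positivity
  -- ONE HEIGHT: on `j ≤ K`, `j ≤ m (K − j + 1)` the bad-height event has mass `≤ A'·2^{−(K−j)}`
  have hheight : ∀ K j : ℕ, j ≤ K → j ≤ m * (K - j + 1) →
      (gibbsK F ℰp γ K).real
          {U | ¬ PlaqSmall (θBal F.L γ b₀ p₀ (K - j))
            (Averaging.iter (fun i => BlockAveraging.blockAvg (P := F.P K) (j := i) ℰp) j U)} ≤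
        A' * ((1 : ℝ) / 2) ^ (K - j) := by
    intro K j hjK hjm
    haveI := isProbabilityMeasure_gibbsK F ℰp hγ.le K
    set hh := K - j with hhdef
    -- the rated bound, with the rate absorbed
    have hβ : (F.L : ℝ) ^ hh ≤ (γ * ((F.L : ℝ)⁻¹) ^ hh)⁻¹ := pow_le_beta F hγ hγ1 hh
    have hβ0 : 0 ≤ (γ * ((F.L : ℝ)⁻¹) ^ hh)⁻¹ := (pow_pos hL0 hh).le.trans hβ
    have hrate : R ^ j * (γ * ((F.L : ℝ)⁻¹) ^ hh)⁻¹ ^ A ≤ R ^ m * (γ * ((F.L : ℝ)⁻¹) ^ hh)⁻¹ ^ (A + N'') := by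
      have h1 : R ^ j ≤ R ^ m * (R ^ m) ^ hh := pow_le_pow_mul_pow hR hjm
      have h2 : (R ^ m) ^ hh ≤ (γ * ((F.L : ℝ)⁻¹) ^ hh)⁻¹ ^ N'' :=
        calc (R ^ m) ^ hh ≤ ((F.L : ℝ) ^ N'') ^ hh := pow_le_pow_left₀ hRm0 hN''.le hh
          _ = ((F.L : ℝ) ^ hh) ^ N'' := by rw [← pow_mul, ← pow_mul, mul_comm]
          _ ≤ (γ * ((F.L : ℝ)⁻¹) ^ hh)⁻¹ ^ N'' := pow_le_pow_left₀ (pow_pos hL0 hh).le hβ N''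
      calc R ^ j * (γ * ((F.L : ℝ)⁻¹) ^ hh)⁻¹ ^ A ≤ (R ^ m * (R ^ m) ^ hh) * (γ * ((F.L : ℝ)⁻¹) ^ hh)⁻¹ ^ A :=
            mul_le_mul_of_nonneg_right h1 (pow_nonneg hβ0 A)
        _ ≤ (R ^ m * (γ * ((F.L : ℝ)⁻¹) ^ hh)⁻¹ ^ N'') * (γ * ((F.L : ℝ)⁻¹) ^ hh)⁻¹ ^ A :=
            mul_le_mul_of_nonneg_right (mul_le_mul_of_nonneg_left h2 hRm0) (pow_nonneg hβ0 A)
        _ = R ^ m * (γ * ((F.L : ℝ)⁻¹) ^ hh)⁻¹ ^ (A + N'') := by rw [pow_add]; ring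
    have hplaq : ∀ p : Plaq (F.P K) j,
        (gibbsK F ℰp γ K).real
            {U | θBal F.L γ b₀ p₀ hh ≤
              GaugeGroup.dist1 (GaugeField.plaqHol
                (Averaging.iter (fun i => BlockAveraging.blockAvg (P := F.P K) (j := i) ℰp) j U) p)} ≤
          C' * (F.scheme ℰp γ).β hh ^ (A + N'') *
            Real.exp (-(c * B10.pFun b₀ p₀ (Real.sqrt (γ * ((F.L : ℝ)⁻¹) ^ hh)) ^ 2)) := by
      intro p
      refine (h K j hjK p).trans ?_
      show C * R ^ j * (γ * ((F.L : ℝ)⁻¹) ^ hh)⁻¹ ^ A * _ ≤ C * R ^ m * (γ * ((F.L : ℝ)⁻¹) ^ hh)⁻¹ ^ (A + N'') * _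
      have := mul_le_mul_of_nonneg_left hrate hC
      have hexp0 : 0 ≤ Real.exp (-(c * B10.pFun b₀ p₀ (Real.sqrt (γ * ((F.L : ℝ)⁻¹) ^ hh)) ^ 2)) := (Real.exp_pos _).le
      calc C * R ^ j * (γ * ((F.L : ℝ)⁻¹) ^ hh)⁻¹ ^ A * Real.exp (-(c * B10.pFun b₀ p₀ (Real.sqrt (γ * ((F.L : ℝ)⁻¹) ^ hh)) ^ 2))
          = (C * (R ^ j * (γ * ((F.L : ℝ)⁻¹) ^ hh)⁻¹ ^ A)) * Real.exp (-(c * B10.pFun b₀ p₀ (Real.sqrt (γ * ((F.L : ℝ)⁻¹) ^ hh)) ^ 2)) := by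
            ring
        _ ≤ (C * (R ^ m * (γ * ((F.L : ℝ)⁻¹) ^ hh)⁻¹ ^ (A + N''))) *
              Real.exp (-(c * B10.pFun b₀ p₀ (Real.sqrt (γ * ((F.L : ℝ)⁻¹) ^ hh)) ^ 2)) :=
            mul_le_mul_of_nonneg_right this hexp0
        _ = _ := by ring
    -- union over the plaquettes of the height, then `perHeight_bound`
    have hunion := real_not_plaqSmall_comp_le_sum (gibbsK F ℰp γ K)
      (fun U => Averaging.iter (fun i => BlockAveraging.blockAvg (P := F.P K) (j := i) ℰp) j U) (θBal F.L γ b₀ p₀ hh)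
    refine hunion.trans ?_
    refine (Finset.sum_le_sum fun p _ => hplaq p).trans ?_
    rw [Finset.sum_const, Finset.card_univ, nsmul_eq_mul]
    have hnonneg : 0 ≤ C' * (F.scheme ℰp γ).β hh ^ (A + N'') *
        Real.exp (-(c * B10.pFun b₀ p₀ (Real.sqrt (γ * ((F.L : ℝ)⁻¹) ^ hh)) ^ 2)) :=
      mul_nonneg (mul_nonneg hC'0 (pow_nonneg (F.scheme_β_nonneg ℰp hγ.le hh) _)) (Real.exp_nonneg _)
    refine (mul_le_mul_of_nonneg_right (card_plaq_le_height F hjK) hnonneg).trans ?_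
    rw [hA', show (72 : ℝ) * (F.L : ℝ) ^ (3 * F.m) * ((F.L : ℝ) ^ hh) ^ 3 = 9 * (8 * (F.L : ℝ) ^ (3 * F.m) * ((F.L : ℝ) ^ hh) ^ 3) by ring]
    exact perHeight_bound F hγ hγ1 hb₀ hp₀ hC'0 (A + N'') hc hh
  -- THE TWO RUNS: sum over the constrained heights `h ≥ ⌊K/m⌋`
  refine ⟨fun K => 4 * A' * ((1 : ℝ) / 2) ^ (K / m), ?_, fun K => ⟨?_, ?_⟩⟩
  · have hs : Summable (fun n : ℕ => 4 * A' * ((1 : ℝ) / 2) ^ n) :=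
      (summable_geometric_of_lt_one (by norm_num) (by norm_num)).mul_left (4 * A')
    exact summable_comp_div (T := fun n => 4 * A' * ((1 : ℝ) / 2) ^ n) (fun n => by positivity) hs hm
  · -- run `K`, heights `h = K − j ≥ ⌊K/m⌋`
    haveI := isProbabilityMeasure_gibbsK F ℰp hγ.le K
    beta_reduce
    have hKm : K < m * (K / m + 1) := Nat.lt_mul_div_succ K hm
    have hn : K / m ≤ K := Nat.div_le_self K m
    generalize hq : K / m = q at hKm hn ⊢
    clear hq
    refine (real_compl_histGood_le_sum F ℰp (θBal F.L γ b₀ p₀) K q (gibbsK F ℰp γ K)).trans ?_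
    have e1 : K - q + q = K := Nat.sub_add_cancel hn
    refine (Finset.sum_le_sum fun j hj => hheight K j ?_ ?_).trans ?_
    · have := Finset.mem_range.mp hj; omega
    · have := Finset.mem_range.mp hj
      have h1 : q + 1 ≤ K - j + 1 := by omega
      calc j ≤ K := by omega
        _ ≤ m * (q + 1) := hKm.le
        _ ≤ m * (K - j + 1) := Nat.mul_le_mul_left m h1
    · rw [← Finset.mul_sum]
      calc A' * ∑ j ∈ Finset.range (K - q + 1), ((1 : ℝ) / 2) ^ (K - j) ≤ A' * (2 * ((1 : ℝ) / 2) ^ q) :=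
            mul_le_mul_of_nonneg_left (sum_range_half_pow_le hn) hA'0
        _ ≤ 4 * A' * ((1 : ℝ) / 2) ^ q := by nlinarith [pow_nonneg (by norm_num : (0 : ℝ) ≤ 1 / 2) q]
  · -- run `K+1`, heights `h = K + 1 − j ≥ ⌊K/m⌋`
    haveI := isProbabilityMeasure_gibbsK F ℰp hγ.le (K + 1)
    beta_reduce
    have hKm : K < m * (K / m + 1) := Nat.lt_mul_div_succ K hm
    have hn : K / m ≤ K + 1 := (Nat.div_le_self K m).trans (Nat.le_succ K)
    generalize hq : K / m = q at hKm hn ⊢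
    clear hq
    refine (real_compl_histGood_le_sum F ℰp (θBal F.L γ b₀ p₀) (K + 1) q (gibbsK F ℰp γ (K + 1))).trans ?_
    have e1 : K + 1 - q + q = K + 1 := Nat.sub_add_cancel hn
    refine (Finset.sum_le_sum fun j hj => hheight (K + 1) j ?_ ?_).trans ?_
    · have := Finset.mem_range.mp hj; omega
    · have := Finset.mem_range.mp hj
      have h1 : q + 1 ≤ K + 1 - j + 1 := by omega
      calc j ≤ K + 1 := by omega
        _ ≤ m * (q + 1) := Nat.succ_le_of_lt hKm
        _ ≤ m * (K + 1 - j + 1) := Nat.mul_le_mul_left m h1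
    · rw [← Finset.mul_sum]
      calc A' * ∑ j ∈ Finset.range (K + 1 - q + 1), ((1 : ℝ) / 2) ^ (K + 1 - j) ≤ A' * (2 * ((1 : ℝ) / 2) ^ q) :=
            mul_le_mul_of_nonneg_left (sum_range_half_pow_le hn) hA'0
        _ ≤ 4 * A' * ((1 : ℝ) / 2) ^ q := by nlinarith [pow_nonneg (by norm_num : (0 : ℝ) ≤ 1 / 2) q]

end Summit.QuantumFields.YangMills.Theorems.CutoffNotchTransport

end
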